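import Summits.CriticalPhenomena.PercolationContinuityZ3.Theorems.PercNearOneGluingNoHeavyLowerTailFrontierDecRowsRow44CutVertex
import Mathlib.Tactic.Linarith
import HarnessLib

/-!
# The cross lemma behind the cut-vertex faces, and frontier dec row 36 (PATH) `E₃(D[a|b], D[a|c], D[b|y]) ≥ 0` across an `{a,c} | {b,y}` cut vertex

Support file for crux `stmt-CriticalPhenomena-4575` (master-family programme: the four-point decreasing `E₃` frontier), seat
`prim-l12-p6` gen 14; memo `run/shared/lean/prim/prim-l12/FROM-prim-l12-p6-g14-OTA-KERNEL-AND-COMB3.md` §3.4.  No definitions,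
no named facts, no sorries.  Companion of `…FrontierDecRowsRow44CutVertex` (row 44 across an `{a,b} | {c,y}` cut vertex).

* `sahiE3_cross_nonneg` — the ABSTRACT CROSS LEMMA.  Two disjoint edge sets `F₁, F₂` carrying the support of `w`; three events
  `N, B, C` whose thinned versions read: `B` = a DECREASING side-1 event, `C` = a decreasing side-2 event, `N` = "NOT (an increasing
  side-1 event `Λ` AND an increasing side-2 event `Ρ`)".  Then `E₃(N, B, C) = P(B∩Λ)(P(C)P(Ρ) − P(C∩Ρ)) + P(C∩Ρ)(P(B)P(Λ) − P(B∩Λ)) ≥ 0`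
  (independence of the sides + Harris for a decreasing and an increasing event, twice).
* `sahiE3_row36_nonneg_of_cutVertex` — row 36 of the frontier (the PATH orbit `D[a|b], D[a|c], D[b|y]`, one of the four independent
  open members `15, 36, 37, 44`) is non-negative on every finite weighted graph in which a vertex `h` separates `{a,c}` from `{b,y}`
  (every positive-weight edge avoiding `h` joins two vertices of the same colour, `a, c` coloured `true`, `b, y` coloured `false`):
  here `Λ = {a ↔ h}` (side 1), `Ρ = {h ↔ b}` (side 2), `B = {a ≁ c}`, `C = {b ≁ y}`, and `{a ↔ b} = Λ ∧ Ρ` across the cut vertex.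
So rows 44 and 36 both live on the cores that are 2-connected between the respective terminal pairs.
-/

noncomputable section

namespace Summit.CriticalPhenomena.PercolationContinuityZ3.Theorems.FrontierDecRows

open MeasureTheory CovTransferCert E3GroupSepCert
open Literature.Probability.Percolation Literature.Probability.LatticeModels

variable {n : ℕ}

/-- **The cross lemma.**  `F₁, F₂` disjoint edge sets with `w = 0` off `F₁ ∪ F₂`; `XB` decreasing and `XL` increasing (read on
`ω ∩ F₁`), `XC` decreasing and `XR` increasing (read on `ω ∩ F₂`); if after thinning to `F₁ ∪ F₂` the event `B` is `XB`, `C` is `XC` and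
`N` is the complement of `XL ∧ XR`, then `0 ≤ E₃(N, B, C)` under `prodBernoulli w` — exactly
`E₃ = P(B∩Λ)(P(C)P(Ρ) − P(C∩Ρ)) + P(C∩Ρ)(P(B)P(Λ) − P(B∩Λ))`, both brackets `≥ 0` by Harris. [this work] -/
theorem sahiE3_cross_nonneg (w : Sym2 (Fin n) → unitInterval) (F₁ F₂ : Finset (Sym2 (Fin n))) (hdisj : Disjoint F₁ F₂)
    (hwD : ∀ e, e ∉ F₁ ∪ F₂ → w e = 0) (N B C XB XL XC XR : Set (Set (Sym2 (Fin n))))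
    (loXB : IsLowerSet XB) (upXL : IsUpperSet XL) (loXC : IsLowerSet XC) (upXR : IsUpperSet XR)
    (tN : {ω : Set (Sym2 (Fin n)) | ω ∩ ↑(F₁ ∪ F₂) ∈ N} =
      ({ω : Set (Sym2 (Fin n)) | ω ∩ ↑F₁ ∈ XL} ∩ {ω | ω ∩ ↑F₂ ∈ XR})ᶜ)
    (tB : {ω : Set (Sym2 (Fin n)) | ω ∩ ↑(F₁ ∪ F₂) ∈ B} = {ω | ω ∩ ↑F₁ ∈ XB})
    (tC : {ω : Set (Sym2 (Fin n)) | ω ∩ ↑(F₁ ∪ F₂) ∈ C} = {ω | ω ∩ ↑F₂ ∈ XC}) :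
    0 ≤ sahiE3 (prodBernoulli w) N B C := by
  classical
  set μ := prodBernoulli w with hμ
  set D : Finset (Sym2 (Fin n)) := F₁ ∪ F₂ with hD
  set EB : Set (Set (Sym2 (Fin n))) := {ω | ω ∩ ↑F₁ ∈ XB} with hEB
  set EC : Set (Set (Sym2 (Fin n))) := {ω | ω ∩ ↑F₂ ∈ XC} with hEC
  set EL : Set (Set (Sym2 (Fin n))) := {ω | ω ∩ ↑F₁ ∈ XL} with hEL
  set ER : Set (Set (Sym2 (Fin n))) := {ω | ω ∩ ↑F₂ ∈ XR} with hER
  -- thinning of the seven probabilities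
  have thin : ∀ A : Set (Set (Sym2 (Fin n))), μ.real A = μ.real {ω | ω ∩ ↑D ∈ A} :=
    fun A => real_eq_real_setOf_inter_mem w D hwD A
  have eNBC : μ.real (N ∩ B ∩ C) = μ.real ((EB ∩ EC) \ ((EB ∩ EL) ∩ (EC ∩ ER))) := by
    rw [thin]
    congr 1
    ext ω
    have e1 := Set.ext_iff.1 tN ω; have e2 := Set.ext_iff.1 tB ω; have e3 := Set.ext_iff.1 tC ω
    simp only [Set.mem_setOf_eq, Set.mem_inter_iff] at e1 e2 e3 ⊢
    simp only [Set.mem_sdiff, Set.mem_inter_iff, Set.mem_compl_iff] at e1 ⊢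
    rw [e1, e2, e3]; tauto
  have eNB : μ.real (N ∩ B) = μ.real (EB \ ((EB ∩ EL) ∩ ER)) := by
    rw [thin]
    congr 1
    ext ω
    have e1 := Set.ext_iff.1 tN ω; have e2 := Set.ext_iff.1 tB ω
    simp only [Set.mem_setOf_eq, Set.mem_inter_iff] at e1 e2 ⊢
    simp only [Set.mem_sdiff, Set.mem_inter_iff, Set.mem_compl_iff] at e1 ⊢
    rw [e1, e2]; tauto
  have eNC : μ.real (N ∩ C) = μ.real (EC \ (EL ∩ (EC ∩ ER))) := by
    rw [thin]
    congr 1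
    ext ω
    have e1 := Set.ext_iff.1 tN ω; have e3 := Set.ext_iff.1 tC ω
    simp only [Set.mem_setOf_eq, Set.mem_inter_iff] at e1 e3 ⊢
    simp only [Set.mem_sdiff, Set.mem_inter_iff, Set.mem_compl_iff] at e1 ⊢
    rw [e1, e3]; tauto
  have eBC : μ.real (B ∩ C) = μ.real (EB ∩ EC) := by
    rw [thin]
    congr 1
    ext ω
    have e2 := Set.ext_iff.1 tB ω; have e3 := Set.ext_iff.1 tC ω
    simp only [Set.mem_setOf_eq, Set.mem_inter_iff] at e2 e3 ⊢
    rw [e2, e3]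
  have eN : μ.real N = μ.real (Set.univ \ (EL ∩ ER)) := by
    rw [thin, tN, Set.compl_eq_univ_sdiff]
  have eB : μ.real B = μ.real EB := by rw [thin, tB]
  have eC : μ.real C = μ.real EC := by rw [thin, tC]
  -- independence of the sides
  have ms : ∀ A : Set (Set (Sym2 (Fin n))), MeasurableSet A := fun A => (Set.toFinite _).measurableSet
  have det₁ : ∀ X : Set (Set (Sym2 (Fin n))), DeterminedBy {ω | ω ∩ ↑F₁ ∈ X} (↑F₁ : Set (Sym2 (Fin n))) := by
    intro X
    rw [determinedBy_iff]
    intro ω ω' hω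
    simp only [Set.mem_setOf_eq, hω]
  have det₂ : ∀ X : Set (Set (Sym2 (Fin n))), DeterminedBy {ω | ω ∩ ↑F₂ ∈ X} (↑F₁ : Set (Sym2 (Fin n)))ᶜ := by
    intro X
    rw [determinedBy_iff]
    intro ω ω' hω
    have hsub : (↑F₂ : Set (Sym2 (Fin n))) ⊆ (↑F₁ : Set (Sym2 (Fin n)))ᶜ := fun e he he1 =>
      Finset.disjoint_left.1 hdisj (Finset.mem_coe.1 he1) (Finset.mem_coe.1 he)
    have : ω ∩ ↑F₂ = ω' ∩ ↑F₂ := by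
      rw [← Set.inter_eq_self_of_subset_right hsub, ← Set.inter_assoc, ← Set.inter_assoc, hω]
    simp only [Set.mem_setOf_eq, this]
  have indep : ∀ X Y : Set (Set (Sym2 (Fin n))),
      μ.real ({ω | ω ∩ ↑F₁ ∈ X} ∩ {ω | ω ∩ ↑F₂ ∈ Y}) = μ.real {ω | ω ∩ ↑F₁ ∈ X} * μ.real {ω | ω ∩ ↑F₂ ∈ Y} :=
    fun X Y => prodBernoulli_real_inter_of_determinedBy w F₁ (det₁ X) (det₂ Y) (ms _) (ms _)
  have hEBL : EB ∩ EL = {ω | ω ∩ ↑F₁ ∈ XB ∩ XL} := by rw [hEB, hEL]; rfl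
  have hECR : EC ∩ ER = {ω | ω ∩ ↑F₂ ∈ XC ∩ XR} := by rw [hEC, hER]; rfl
  have pBC : μ.real (EB ∩ EC) = μ.real EB * μ.real EC := indep _ _
  have pBLCR : μ.real ((EB ∩ EL) ∩ (EC ∩ ER)) = μ.real (EB ∩ EL) * μ.real (EC ∩ ER) := by
    rw [hEBL, hECR]; exact indep _ _
  have pBLR : μ.real ((EB ∩ EL) ∩ ER) = μ.real (EB ∩ EL) * μ.real ER := by rw [hEBL]; exact indep _ _
  have pLCR : μ.real (EL ∩ (EC ∩ ER)) = μ.real EL * μ.real (EC ∩ ER) := by rw [hECR]; exact indep _ _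
  have pLR : μ.real (EL ∩ ER) = μ.real EL * μ.real ER := indep _ _
  -- differences
  have dNBC : μ.real (N ∩ B ∩ C) = μ.real EB * μ.real EC - μ.real (EB ∩ EL) * μ.real (EC ∩ ER) := by
    rw [eNBC, measureReal_sdiff (by intro ω hω; exact ⟨hω.1.1, hω.2.1⟩) (ms _), pBC, pBLCR]
  have dNB : μ.real (N ∩ B) = μ.real EB - μ.real (EB ∩ EL) * μ.real ER := by
    rw [eNB, measureReal_sdiff (by intro ω hω; exact hω.1.1) (ms _), pBLR]
  have dNC : μ.real (N ∩ C) = μ.real EC - μ.real EL * μ.real (EC ∩ ER) := by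
    rw [eNC, measureReal_sdiff (by intro ω hω; exact hω.2.1) (ms _), pLCR]
  have dN : μ.real N = 1 - μ.real EL * μ.real ER := by
    rw [eN, measureReal_sdiff (Set.subset_univ _) (ms _), pLR]
    simp [hμ]
  -- Harris on each side (decreasing × increasing)
  have upEL : IsUpperSet EL := by
    intro ω ω' hle hω
    simp only [hEL, Set.mem_setOf_eq] at hω ⊢
    exact upXL (Set.inter_subset_inter_left _ hle) hω
  have upER : IsUpperSet ER := by
    intro ω ω' hle hω
    simp only [hER, Set.mem_setOf_eq] at hω ⊢
    exact upXR (Set.inter_subset_inter_left _ hle) hω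
  have loEB : IsLowerSet EB := by
    intro ω ω' hle hω
    simp only [hEB, Set.mem_setOf_eq] at hω ⊢
    exact loXB (Set.inter_subset_inter_left _ hle) hω
  have loEC : IsLowerSet EC := by
    intro ω ω' hle hω
    simp only [hEC, Set.mem_setOf_eq] at hω ⊢
    exact loXC (Set.inter_subset_inter_left _ hle) hω
  have harris₁ : μ.real (EB ∩ EL) ≤ μ.real EL * μ.real EB := by
    rw [Set.inter_comm]; exact prodBernoulli_harris_upper_lower w upEL loEB (ms _) (ms _)
  have harris₂ : μ.real (EC ∩ ER) ≤ μ.real ER * μ.real EC := by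
    rw [Set.inter_comm]; exact prodBernoulli_harris_upper_lower w upER loEC (ms _) (ms _)
  -- the identity and the conclusion
  have h0 : 0 ≤ μ.real (EB ∩ EL) := measureReal_nonneg
  have h0' : 0 ≤ μ.real (EC ∩ ER) := measureReal_nonneg
  rw [sahiE3_def, dNBC, dN, eB, eC, eBC, pBC, dNC, dNB]
  nlinarith [mul_nonneg h0 (sub_nonneg.2 harris₂), mul_nonneg h0' (sub_nonneg.2 harris₁)]

/-- **Row 36 (PATH) across an `{a,c} | {b,y}` cut vertex.**  If every positive-weight edge avoiding `h` joins two vertices of the same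
colour (`side`), with `a, c` coloured `true` and `b, y` coloured `false`, then `0 ≤ E₃(D[a|b], D[a|c], D[b|y])` under `prodBernoulli w`
(`E₃ = P({a≁c}∩{a↔h})·(P(b≁y)P(h↔b) − P({b≁y}∩{h↔b})) + P({b≁y}∩{h↔b})·(P(a≁c)P(a↔h) − P({a≁c}∩{a↔h}))`, Harris twice). [this work] -/
theorem sahiE3_row36_nonneg_of_cutVertex (w : Sym2 (Fin n) → unitInterval) (a b c y h : Fin n) (side : Fin n → Bool)
    (ha : side a = true) (hc : side c = true) (hb : side b = false) (hy : side y = false)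
    (hw : ∀ u v : Fin n, u ≠ h → v ≠ h → side u ≠ side v → w s(u, v) = 0) :
    0 ≤ sahiE3 (prodBernoulli w) (connEvent (row 36 n (a, b, c, y)).1) (connEvent (row 36 n (a, b, c, y)).2.1)
      (connEvent (row 36 n (a, b, c, y)).2.2) := by
  classical
  have hrow : row 36 n (a, b, c, y) = (sep [a] [b], sep [a] [c], sep [b] [y]) := rfl
  simp only [hrow, connEvent_sep]
  have hab : a ≠ b := fun e => by rw [e, hb] at ha; exact Bool.false_ne_true ha
  -- the two edge sets
  set F₁ : Finset (Sym2 (Fin n)) := Finset.univ.filter (fun e => ∀ u ∈ e, side u = true ∨ u = h) with hF₁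
  set F₂ : Finset (Sym2 (Fin n)) :=
    Finset.univ.filter (fun e => (∀ u ∈ e, side u = false ∨ u = h) ∧ ¬ ∀ u ∈ e, u = h) with hF₂
  have mem₁ : ∀ e, e ∈ F₁ ↔ ∀ u ∈ e, side u = true ∨ u = h := fun e => by rw [hF₁, Finset.mem_filter]; simp
  have mem₂ : ∀ e, e ∈ F₂ ↔ (∀ u ∈ e, side u = false ∨ u = h) ∧ ¬ ∀ u ∈ e, u = h := fun e => by
    rw [hF₂, Finset.mem_filter]; simp
  have hdisj : Disjoint F₁ F₂ := by
    rw [Finset.disjoint_left]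
    intro e h1 h2
    rw [mem₁] at h1; rw [mem₂] at h2
    apply h2.2
    intro u hu
    rcases h1 u hu with h1 | h1
    · rcases h2.1 u hu with h2 | h2
      · rw [h1] at h2; exact absurd h2 (by decide)
      · exact h2
    · exact h1
  have hwD : ∀ e, e ∉ F₁ ∪ F₂ → w e = 0 := by
    intro e he
    rw [Finset.mem_union, not_or, mem₁, mem₂] at he
    obtain ⟨h1, h2⟩ := he
    induction e using Sym2.ind with
    | h u v =>
      have key : u ≠ h ∧ v ≠ h ∧ side u ≠ side v := by
        by_cases hu : u = h
        · subst hu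
          exfalso
          by_cases hv : v = u
          · exact h1 fun x hx => Or.inr (by rcases Sym2.mem_iff.1 hx with e | e <;> [exact e; exact e.trans hv])
          · cases hsv : side v
            · exact h2 ⟨fun x hx => by rcases Sym2.mem_iff.1 hx with e | e <;> [exact Or.inr e; exact Or.inl (e ▸ hsv)],
                fun hall => hv (hall v (Sym2.mem_iff.2 (Or.inr rfl)))⟩
            · exact h1 fun x hx => by rcases Sym2.mem_iff.1 hx with e | e <;> [exact Or.inr e; exact Or.inl (e ▸ hsv)]
        · by_cases hv : v = h
          · subst hv
            exfalso
            cases hsu : side u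
            · exact h2 ⟨fun x hx => by rcases Sym2.mem_iff.1 hx with e | e <;> [exact Or.inl (e ▸ hsu); exact Or.inr e],
                fun hall => hu (hall u (Sym2.mem_iff.2 (Or.inl rfl)))⟩
            · exact h1 fun x hx => by rcases Sym2.mem_iff.1 hx with e | e <;> [exact Or.inl (e ▸ hsu); exact Or.inr e]
          · refine ⟨hu, hv, fun hse => ?_⟩
            cases hsu : side u
            · exact h2 ⟨fun x hx => by
                  rcases Sym2.mem_iff.1 hx with e | e <;> [exact Or.inl (e ▸ hsu); exact Or.inl (e ▸ (hse ▸ hsu))],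
                fun hall => hu (hall u (Sym2.mem_iff.2 (Or.inl rfl)))⟩
            · exact h1 fun x hx => by
                rcases Sym2.mem_iff.1 hx with e | e <;> [exact Or.inl (e ▸ hsu); exact Or.inl (e ▸ (hse ▸ hsu))]
      exact hw u v key.1 key.2.1 key.2.2
  -- side graphs of a configuration
  have hT : ∀ ω : Set (Sym2 (Fin n)), ∀ v u u', (openGraph (ω ∩ ↑F₁)).Adj v u → (openGraph (ω ∩ ↑F₂)).Adj v u' → v = h := by
    intro ω v u u' h1 h2
    rw [openGraph_adj] at h1 h2
    have e1 := (mem₁ _).1 (Finset.mem_coe.1 h1.1.2) v (Sym2.mem_iff.2 (Or.inl rfl))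
    have e2 := ((mem₂ _).1 (Finset.mem_coe.1 h2.1.2)).1 v (Sym2.mem_iff.2 (Or.inl rfl))
    rcases e1 with e1 | e1
    · rcases e2 with e2 | e2
      · rw [e1] at e2; exact absurd e2 (by decide)
      · exact e2
    · exact e1
  have iso₂ : ∀ ω : Set (Sym2 (Fin n)), ∀ x, side x = true → x ≠ h → ∀ u, ¬ (openGraph (ω ∩ ↑F₂)).Adj x u := by
    intro ω x hx hxh u hadj
    rw [openGraph_adj] at hadj
    rcases ((mem₂ _).1 (Finset.mem_coe.1 hadj.1.2)).1 x (Sym2.mem_iff.2 (Or.inl rfl)) with e | e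
    · rw [hx] at e; exact Bool.noConfusion e
    · exact hxh e
  have iso₁ : ∀ ω : Set (Sym2 (Fin n)), ∀ x, side x = false → x ≠ h → ∀ u, ¬ (openGraph (ω ∩ ↑F₁)).Adj x u := by
    intro ω x hx hxh u hadj
    rw [openGraph_adj] at hadj
    rcases (mem₁ _).1 (Finset.mem_coe.1 hadj.1.2) x (Sym2.mem_iff.2 (Or.inl rfl)) with e | e
    · rw [hx] at e; exact Bool.noConfusion e
    · exact hxh e
  have hsup : ∀ ω : Set (Sym2 (Fin n)), openGraph (ω ∩ ↑(F₁ ∪ F₂)) = openGraph (ω ∩ ↑F₁) ⊔ openGraph (ω ∩ ↑F₂) := by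
    intro ω
    rw [Finset.coe_union, Set.inter_union_distrib_left]
    exact SimpleGraph.fromEdgeSet_union _ _
  -- translation of the three events and the cross lemma
  refine sahiE3_cross_nonneg w F₁ F₂ hdisj hwD _ _ _ (openConn a c)ᶜ (openConn a h) (openConn b y)ᶜ (openConn h b)
    (isUpperSet_openConn a c).compl (isUpperSet_openConn a h) (isUpperSet_openConn b y).compl (isUpperSet_openConn h b) ?_ ?_ ?_
  · ext ω
    simp only [Set.mem_setOf_eq, Set.mem_compl_iff, Set.mem_inter_iff, openConn, List.mem_singleton, forall_eq, hsup ω]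
    rw [reachable_sup_iff_cross (hT ω) (iso₂ ω a ha) (iso₁ ω b hb) hab]
  · ext ω
    simp only [Set.mem_setOf_eq, List.mem_singleton, forall_eq, Set.mem_compl_iff, openConn, hsup ω]
    exact not_congr (reachable_sup_iff_left (hT ω) (iso₂ ω a ha) (iso₂ ω c hc))
  · ext ω
    simp only [Set.mem_setOf_eq, List.mem_singleton, forall_eq, Set.mem_compl_iff, openConn, hsup ω]
    rw [sup_comm]
    exact not_congr (reachable_sup_iff_left (fun v u u' h2 h1 => hT ω v u' u h1 h2) (iso₁ ω b hb) (iso₁ ω y hy))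

end Summit.CriticalPhenomena.PercolationContinuityZ3.Theorems.FrontierDecRows
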